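import Literature.Topology.FourManifolds.RasmussenSliceProofs
import Literature.Topology.FourManifolds.LeeRasmussenRankHolds
import HarnessLib

/-!
# Slice knots have `s = 0`: Corollary 4.2 of Rasmussen at the chain level (sibling of `Rasmussen.lean`)

Third sibling proof file for the named fact
`Literature.Topology.FourManifolds.eq_zero_of_isSmoothlySlice` of `Rasmussen.lean` (`s(K) = 0`
for a smoothly slice knot `K`; J. Rasmussen, *Khovanov homology and the slice genus*, Invent.
Math. 182 (2010) 419–447 = arXiv:math/0402131, Thm. 1, the case `g = 0`), after
`RasmussenProofs.lean` and `RasmussenSliceProofs.lean`. Everything here is **proved**; no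
definition and no named fact is introduced (D-0026).

The assembly `eq_zero_of_isSmoothlySlice_of_filtered` (`RasmussenSliceProofs.lean`) reduces the
fact to maps of degree-zero Lee *cycles* `P.diagram ⇄ GaussDiagram.empty` which are injective on
*homology classes* and do not decrease the filtration. In Rasmussen's proof these maps are the
cobordism maps `φ_C`, `φ_{C̄}` of the concordance `C : K → U` cut out of a slice disc (§4.2), and
their injectivity on homology is **Corollary 4.2** (*"If `S` is a connected cobordism between
knots `K₀` and `K₁`, then `φ_S` is an isomorphism"*, p. 9 of the arXiv text), whose printed proof
is: *"Fix an orientation `o` on `S`. Then `{𝔰_{o₀}, 𝔰_{ō₀}}` is a basis for `Kh'(K₀)`"* — Lee's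
theorem, Lee (2005), Thm. 4.2 — *"Its image under `φ_S` is `{k₁ 𝔰_{o₁}, k₂ 𝔰_{ō₁}}`
(`k₁, k₂ ≠ 0`)"* — Proposition 4.1, whose proof (p. 9, "the claim") tracks the canonical
generators at the **chain level** through the elementary cobordisms, `𝔰_o ↦ Σ a_I 𝔰_{o_I}`
modulo boundaries — *"which is a basis for `Kh'(K₁)`"*.

Since the tree now has Lee's theorem for diagrams of knots (`finrank_leeHomologyZero_eq_two_holds`,
`LeeRasmussenRankHolds.lean`, through the chain contraction `D H + H D = 1 - Π` of
`LeeRasmussenContractionProofs.lean` and the merge/split dichotomy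
`isMergeAt_or_isSplitAt_of_hasGaussDiagram_holds`), this file proves Corollary 4.2's mechanism
and restates the assembly with purely **chain-level** hypotheses, so that the remaining input —
the maps induced by a movie of Reidemeister and Morse moves through *link* diagrams (Rasmussen
§4.1–4.3, §6), which the tree does not have — needs no homology of link diagrams at all:

* Lee's theorem in chain form (`§ LeeChain`): the Lee coordinates (`GaussDiagram.leeCoord`) of a
  degree-zero *boundary* vanish at the canonical states (the degree-zero enhanced states with no
  free chord, `card_noFree_degStates_zero`: Lee's `𝔰_o`, `𝔰_ō`) — for every Gauss diagram
  (`leeCoord_apply_eq_zero_of_mem_range`, from `Π D = 0`); the canonical generators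
  `(leeCoord 0).symm (Pi.single s 1)` are cycles (`khovanovD_leeCoord_symm_single`, from
  `D Π = 0`); and, for a diagram realised by a knot, a degree-zero cycle whose Lee coordinates
  vanish at the canonical states is a boundary (`mem_range_of_leeCoord_apply_eq_zero`, from
  `D H + H D = 1 - Π`), so every cycle is its canonical part plus a boundary
  (`sub_sum_canonical_mem_range`). This is *"`{[𝔰_o], [𝔰_ō]}` is a basis for `Kh'(K)`"*
  (Lee (2005), Thm. 4.2; Rasmussen (2010), §2.3–2.4) with explicit representatives.
* Corollary 4.2, injectivity half (`mem_range_of_canonical`, `mk_eq_zero_of_canonical`): a linear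
  map `F` of degree-zero Lee chains `G → G'` (`G` realised by a knot) that sends boundaries to
  boundaries and sends each canonical generator of `G` to a nonzero multiple of a canonical
  generator of `G'` modulo boundaries, injectively on canonical states (the conclusion of the
  claim in the proof of Prop. 4.1 for a weakly connected cobordism between knot diagrams), kills
  no nonzero homology class.
* The assembly (`eq_zero_of_isSmoothlySlice_of_canonical`): the named fact
  `eq_zero_of_isSmoothlySlice` follows as soon as every regular projection `P` of a smoothly
  slice knot comes with linear maps of degree-zero Lee chains
  `C⁰(P.diagram) ⇄ C⁰(GaussDiagram.empty)` which map cycles to cycles and boundaries to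
  boundaries, do not decrease `qMin` (filtered of degree `χ(C) = 0`, §4.2, eq. (4.1)), and track
  the canonical generators as above (Prop. 4.1) — exactly what the chain maps `φ_C`, `φ_{C̄}` of
  Rasmussen's §4 deliver *before* passing to homology.

## References

* J. Rasmussen, *Khovanov homology and the slice genus*, Invent. Math. 182 (2010) 419–447
  (arXiv:math/0402131): §2.3–2.4 (canonical generators, Lee's basis), §4.2 (induced maps,
  filtered of degree `χ(S)`), Prop. 4.1 and its proof (p. 9: chain-level tracking of `𝔰_o`),
  Cor. 4.2 (p. 9), §4.4 (proof of Thm. 1, p. 10). [cite: Rasmussen2010, Cor. 4.2]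
* E. S. Lee, *An endomorphism of the Khovanov invariant*, Adv. Math. 197 (2005) 554–586,
  Thm. 4.2, §4.4.3. [cite: Lee2005, Thm. 4.2]

## Design notes

No definitions, no named facts, no instances. Canonical states of `G` are the elements of
`{s : G.degStates 0 // ∀ i, ¬ G.Free s.1.label i}` (exactly two for a diagram satisfying Gauss
parity, `card_noFree_degStates_zero`; they are `leeState hpar t`), and the canonical generator
of `s` is `(G.leeCoord 0).symm (Pi.single s.1 1)`, the chain whose Lee coordinates are the
indicator of `s`; boundaries and cycles are `LinearMap.range (G.khovanovD ℚ 0 1 (0 - 1) 0)` and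
`G.leeCycles = LinearMap.ker (G.khovanovD ℚ 0 1 0 (0 + 1))`, the two submodules of which
`G.LeeHomologyZero` is literally the subquotient. Realisability of `GaussDiagram.empty` is
`unknot_hasGaussDiagram_empty_holds` with the instance `SphereEmbedding.smoothnessFacts`.
-/

open Function Set

noncomputable section

namespace Literature.Topology.FourManifolds

namespace GaussDiagram

variable {G G' : GaussDiagram}

/-! ## Lee's theorem in chain form -/

section LeeChain

/-- **The projector fixes the canonical coordinate vectors**: `Π e_s = e_s` for a degree-zero
enhanced state `s` with no free chord (`leeProjMat 0` is the diagonal `0/1` matrix supported on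
such states). Lee (2005), §4.4.3. [cite: Lee2005, Thm. 4.2] -/
theorem leeProjMat_toLin'_single {s : G.degStates 0} (hs : ∀ i, ¬ G.Free s.1.label i) :
    Matrix.toLin' (G.leeProjMat 0) (Pi.single s 1) = Pi.single s 1 := by
  ext u
  rw [Matrix.toLin'_apply, leeProjMat, Matrix.mulVec_diagonal]
  by_cases hu : u = s
  · subst hu
    rw [if_pos hs, one_mul]
  · rw [Pi.single_eq_of_ne hu, mul_zero]

/-- **Lee coordinates of a boundary vanish at the canonical states** (every Gauss diagram): if
`x = d₋₁ y` is a degree-zero Lee boundary then `leeCoord 0 x` vanishes at every degree-zero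
enhanced state with no free chord, because in Lee's coordinates the differential is
label-preserving and its image is spanned by generators with a free chord (`Π D = 0`,
`leeProjMat_mul_leeDiffMat`). Lee (2005), §4.4.3; Rasmussen (2010), §2.3 (the canonical
generators are not hit by the differential). [cite: Lee2005, Thm. 4.2] -/
theorem leeCoord_apply_eq_zero_of_mem_range {x : G.degStates 0 → ℚ}
    (hx : x ∈ LinearMap.range (G.khovanovD ℚ 0 1 (0 - 1) 0)) {s : G.degStates 0}
    (hs : ∀ i, ¬ G.Free s.1.label i) : G.leeCoord 0 x s = 0 := by
  obtain ⟨y, rfl⟩ := hx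
  have h2 : Matrix.toLin' (G.leeProjMat 0) (G.leeCoord 0 (G.khovanovD ℚ 0 1 (0 - 1) 0 y)) s = 0 := by
    rw [leeCoord_khovanovD, ← Matrix.toLin'_mul_apply, leeProjMat_mul_leeDiffMat, map_zero,
      LinearMap.zero_apply, Pi.zero_apply]
  rwa [Matrix.toLin'_apply, leeProjMat, Matrix.mulVec_diagonal, if_pos hs, one_mul] at h2

/-- **The canonical generators are cycles** (every Gauss diagram): the chain
`(leeCoord 0).symm (Pi.single s 1)` whose Lee coordinates are the indicator of a degree-zero
enhanced state `s` with no free chord is killed by `d₀` (`D Π = 0`, `leeDiffMat_mul_leeProjMat`: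
a generator with no free chord has zero Lee differential). These are Lee's `𝔰_o`, `𝔰_ō`
(`leeState`). Lee (2005), §4.4.3; Rasmussen (2010), §2.3. [cite: Rasmussen2010, §2.3] -/
theorem khovanovD_leeCoord_symm_single {s : G.degStates 0} (hs : ∀ i, ¬ G.Free s.1.label i) :
    G.khovanovD ℚ 0 1 0 (0 + 1) ((G.leeCoord 0).symm (Pi.single s 1)) = 0 := by
  rw [khovanovD_leeCoord_symm, ← leeProjMat_toLin'_single hs, ← Matrix.toLin'_mul_apply,
    leeDiffMat_mul_leeProjMat, map_zero, LinearMap.zero_apply, map_zero]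

/-- The canonical generators are degree-zero Lee cycles (membership form of
`khovanovD_leeCoord_symm_single`). [cite: Rasmussen2010, §2.3] -/
theorem leeCoord_symm_single_mem_leeCycles {s : G.degStates 0}
    (hs : ∀ i, ¬ G.Free s.1.label i) :
    (G.leeCoord 0).symm (Pi.single s 1) ∈ G.leeCycles :=
  LinearMap.mem_ker.2 (khovanovD_leeCoord_symm_single hs)

/-- **A cycle with vanishing canonical Lee coordinates is a boundary** (diagrams of knots): if
`G` is realised by a knot, `z` is a degree-zero Lee cycle and `leeCoord 0 z` vanishes at every
degree-zero enhanced state with no free chord, then `z ∈ im d₋₁`. Proof: the chain contraction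
`D H + H D = 1 - Π` of Lee's complex in Lee's coordinates (`leeDiffMat_mul_leeHtpyMat_add`, valid
under the merge/split dichotomy, which holds for realisable diagrams,
`isMergeAt_or_isSplitAt_of_hasGaussDiagram_holds`) gives `z = d₋₁ (H z) + Π z`, and `Π z = 0` by
hypothesis. This is the spanning half of Lee's theorem *"`Kh'(K)` has basis `[𝔰_o], [𝔰_ō]`"*
with explicit representatives. Lee (2005), Thm. 4.2; Rasmussen (2010), §2.3–2.4.
[cite: Lee2005, Thm. 4.2] -/
theorem mem_range_of_leeCoord_apply_eq_zero (hG : ∃ K : Knot, K.HasGaussDiagram G)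
    {z : G.degStates 0 → ℚ} (hz : z ∈ G.leeCycles)
    (h0 : ∀ s : G.degStates 0, (∀ i, ¬ G.Free s.1.label i) → G.leeCoord 0 z s = 0) :
    z ∈ LinearMap.range (G.khovanovD ℚ 0 1 (0 - 1) 0) := by
  have hms : ∀ (σ : G.State) (i : Fin G.n), σ i = false → G.IsMergeAt σ i ∨ G.IsSplitAt σ i :=
    fun _ _ h ↦ isMergeAt_or_isSplitAt_of_hasGaussDiagram_holds hG h
  have hId := leeDiffMat_mul_leeHtpyMat_add hms 0
  set v := G.leeCoord 0 z with hv
  have hDv : Matrix.toLin' (G.leeDiffMat 0 (0 + 1)) v = 0 := by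
    have h1 := leeCoord_khovanovD 0 (0 + 1) z
    rw [LinearMap.mem_ker.1 hz, map_zero] at h1
    exact h1.symm
  have hPv : Matrix.toLin' (G.leeProjMat 0) v = 0 := by
    ext s
    rw [Matrix.toLin'_apply, leeProjMat, Matrix.mulVec_diagonal, Pi.zero_apply]
    by_cases hs : ∀ i, ¬ G.Free s.1.label i
    · rw [if_pos hs, one_mul]
      exact h0 s hs
    · rw [if_neg hs, zero_mul]
  have hvsum : Matrix.toLin' (G.leeDiffMat (0 - 1) 0)
      (Matrix.toLin' (G.leeHtpyMat 0 (0 - 1)) v) = v := by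
    have h1 := congrArg (fun M ↦ Matrix.toLin' M v) hId
    simp only [map_add, map_sub, LinearMap.add_apply, LinearMap.sub_apply,
      Matrix.toLin'_mul_apply, Matrix.toLin'_one, LinearMap.id_apply, hDv, map_zero, hPv,
      add_zero, sub_zero] at h1
    exact h1
  refine ⟨(G.leeCoord (0 - 1)).symm (Matrix.toLin' (G.leeHtpyMat 0 (0 - 1)) v), ?_⟩
  rw [khovanovD_leeCoord_symm, hvsum, hv, LinearEquiv.symm_apply_apply]

/-- **Every cycle is its canonical part plus a boundary** (diagrams of knots): for a degree-zero
Lee cycle `z` of a diagram realised by a knot,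
`z - Σ_s (leeCoord 0 z s) • (leeCoord 0).symm e_s ∈ im d₋₁`, the sum running over the
degree-zero enhanced states `s` with no free chord (Lee's two canonical states). In homology:
`[z] = Σ_s (leeCoord 0 z s) [𝔰_s]`, i.e. the canonical classes span `Kh'⁰`. Lee (2005),
Thm. 4.2; Rasmussen (2010), §2.4 (*"`{𝔰_o, 𝔰_ō}` is a basis for `Kh'(K)`"*).
[cite: Lee2005, Thm. 4.2] -/
theorem sub_sum_canonical_mem_range (hG : ∃ K : Knot, K.HasGaussDiagram G)
    {z : G.degStates 0 → ℚ} (hz : z ∈ G.leeCycles) :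
    z - ∑ s : {s : G.degStates 0 // ∀ i, ¬ G.Free s.1.label i},
        G.leeCoord 0 z s.1 • (G.leeCoord 0).symm (Pi.single s.1 1) ∈
      LinearMap.range (G.khovanovD ℚ 0 1 (0 - 1) 0) := by
  refine mem_range_of_leeCoord_apply_eq_zero hG
    (Submodule.sub_mem _ hz (Submodule.sum_mem _ fun s _ ↦
      Submodule.smul_mem _ _ (leeCoord_symm_single_mem_leeCycles s.2))) fun u hu ↦ ?_
  rw [map_sub, map_sum, Pi.sub_apply, Finset.sum_apply,
    Finset.sum_eq_single (⟨u, hu⟩ : {s : G.degStates 0 // ∀ i, ¬ G.Free s.1.label i})]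
  · rw [map_smul, LinearEquiv.apply_symm_apply, Pi.smul_apply, Pi.single_eq_same, smul_eq_mul,
      mul_one, sub_self]
  · intro s _ hs
    have hne : u ≠ s.1 := fun h ↦ hs (Subtype.ext h.symm)
    rw [map_smul, LinearEquiv.apply_symm_apply, Pi.smul_apply, Pi.single_eq_of_ne hne,
      smul_zero]
  · intro h
    exact absurd (Finset.mem_univ _) h

/-- **The canonical generators are independent modulo boundaries** (every Gauss diagram): if a
linear combination `Σ_s a_s • (leeCoord 0).symm e_s` of canonical generators is a boundary, all
its coefficients vanish (apply `leeCoord_apply_eq_zero_of_mem_range`). In homology, for a diagram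
of a knot: the canonical classes `[𝔰_o], [𝔰_ō]` are linearly independent. Lee (2005), Thm. 4.2;
Rasmussen (2010), §2.4. [cite: Lee2005, Thm. 4.2] -/
theorem eq_zero_of_sum_canonical_mem_range
    {a : {s : G.degStates 0 // ∀ i, ¬ G.Free s.1.label i} → ℚ}
    (h : ∑ s, a s • (G.leeCoord 0).symm (Pi.single s.1 1) ∈
      LinearMap.range (G.khovanovD ℚ 0 1 (0 - 1) 0))
    (s : {s : G.degStates 0 // ∀ i, ¬ G.Free s.1.label i}) : a s = 0 := by
  have h1 := leeCoord_apply_eq_zero_of_mem_range h s.2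
  rw [map_sum, Finset.sum_apply, Finset.sum_eq_single s] at h1
  · rwa [map_smul, LinearEquiv.apply_symm_apply, Pi.smul_apply, Pi.single_eq_same, smul_eq_mul,
      mul_one] at h1
  · intro s' _ hs'
    have hne : s.1 ≠ s'.1 := fun h ↦ hs' (Subtype.ext h.symm)
    rw [map_smul, LinearEquiv.apply_symm_apply, Pi.smul_apply, Pi.single_eq_of_ne hne, smul_zero]
  · intro h
    exact absurd (Finset.mem_univ _) h

end LeeChain

/-! ## Corollary 4.2: canonical tracking gives injectivity on homology -/

section Corollary

/-- **Rasmussen's Corollary 4.2, chain form.** Let `G` be a Gauss diagram realised by a knot and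
`F : C⁰(G) → C⁰(G')` a linear map of degree-zero Lee chains which sends boundaries to boundaries
and sends the canonical generator of each canonical state `s` of `G` to a nonzero multiple of the
canonical generator of a canonical state `e s` of `G'` modulo boundaries, with `e` injective —
the conclusion of the claim in the proof of Prop. 4.1 for the chain map of a weakly connected
cobordism whose far end is a knot (one permissible orientation for each orientation of the near
end). Then a cycle `z` of `G` with `F z` a boundary of `G'` is a boundary of `G`: write
`z = Σ a_s 𝔰_s + d y` (`sub_sum_canonical_mem_range`), so that `Σ a_s c_s 𝔰'_{e s}` is a
boundary of `G'`, whence `a_s c_s = 0` (`leeCoord_apply_eq_zero_of_mem_range`) and `a_s = 0`,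
and conclude by `mem_range_of_leeCoord_apply_eq_zero`. Rasmussen (2010), Cor. 4.2 and its proof
(p. 9), with Prop. 4.1 and Lee (2005), Thm. 4.2. [cite: Rasmussen2010, Cor. 4.2] -/
theorem mem_range_of_canonical (hG : ∃ K : Knot, K.HasGaussDiagram G)
    (F : (G.degStates 0 → ℚ) →ₗ[ℚ] (G'.degStates 0 → ℚ))
    (hFA : ∀ y, F (G.khovanovD ℚ 0 1 (0 - 1) 0 y) ∈
      LinearMap.range (G'.khovanovD ℚ 0 1 (0 - 1) 0))
    (e : {s : G.degStates 0 // ∀ i, ¬ G.Free s.1.label i} →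
      {u : G'.degStates 0 // ∀ i, ¬ G'.Free u.1.label i})
    (he : Injective e)
    (htrack : ∀ s, ∃ c : ℚ, c ≠ 0 ∧
      F ((G.leeCoord 0).symm (Pi.single s.1 1)) - c • (G'.leeCoord 0).symm (Pi.single (e s).1 1)
        ∈ LinearMap.range (G'.khovanovD ℚ 0 1 (0 - 1) 0))
    {z : G.degStates 0 → ℚ} (hz : z ∈ G.leeCycles)
    (hFz : F z ∈ LinearMap.range (G'.khovanovD ℚ 0 1 (0 - 1) 0)) :
    z ∈ LinearMap.range (G.khovanovD ℚ 0 1 (0 - 1) 0) := by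
  choose c hc0 hc using htrack
  obtain ⟨y, hy⟩ := sub_sum_canonical_mem_range hG hz
  -- the coefficients of `z` on the canonical generators
  set a : {s : G.degStates 0 // ∀ i, ¬ G.Free s.1.label i} → ℚ := fun s ↦ G.leeCoord 0 z s.1
    with ha
  -- the image of the canonical part of `z`, modulo boundaries
  have hsum : ∑ s, (a s * c s) • (G'.leeCoord 0).symm (Pi.single (e s).1 1) =
      F z - F (G.khovanovD ℚ 0 1 (0 - 1) 0 y) -
        ∑ s, a s • (F ((G.leeCoord 0).symm (Pi.single s.1 1)) -
          c s • (G'.leeCoord 0).symm (Pi.single (e s).1 1)) := by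
    have h1 : F (G.khovanovD ℚ 0 1 (0 - 1) 0 y) =
        F z - ∑ s, a s • F ((G.leeCoord 0).symm (Pi.single s.1 1)) := by
      rw [hy, map_sub, map_sum]
      simp only [map_smul, ha]
    rw [h1, sub_sub_cancel, ← Finset.sum_sub_distrib]
    refine Finset.sum_congr rfl fun s _ ↦ ?_
    rw [smul_sub, sub_sub_cancel, smul_smul]
  have hmem : ∑ s, (a s * c s) • (G'.leeCoord 0).symm (Pi.single (e s).1 1) ∈
      LinearMap.range (G'.khovanovD ℚ 0 1 (0 - 1) 0) := by
    rw [hsum]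
    exact Submodule.sub_mem _ (Submodule.sub_mem _ hFz (hFA y))
      (Submodule.sum_mem _ fun s _ ↦ Submodule.smul_mem _ _ (hc s))
  -- hence every coefficient `a s * c s` vanishes
  have hzero : ∀ s₀, a s₀ * c s₀ = 0 := by
    intro s₀
    have h1 := leeCoord_apply_eq_zero_of_mem_range hmem (e s₀).2
    rw [map_sum, Finset.sum_apply, Finset.sum_eq_single s₀] at h1
    · rwa [map_smul, LinearEquiv.apply_symm_apply, Pi.smul_apply, Pi.single_eq_same,
        smul_eq_mul, mul_one] at h1
    · intro s _ hs
      have hne : (e s₀).1 ≠ (e s).1 := fun h ↦ hs (he (Subtype.ext h)).symm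
      rw [map_smul, LinearEquiv.apply_symm_apply, Pi.smul_apply, Pi.single_eq_of_ne hne,
        smul_zero]
    · intro h
      exact absurd (Finset.mem_univ _) h
  refine mem_range_of_leeCoord_apply_eq_zero hG hz fun u hu ↦ ?_
  have h1 := hzero ⟨u, hu⟩
  rcases mul_eq_zero.1 h1 with h2 | h2
  · exact h2
  · exact absurd h2 (hc0 _)

/-- **Rasmussen's Corollary 4.2, homology form**: under the hypotheses of
`mem_range_of_canonical` and if moreover `F` maps cycles to cycles, the induced map on
degree-zero Lee cycles kills no nonzero Lee homology class — the hypothesis `hφ`/`hψ` of the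
assemblies `eq_zero_of_isSmoothlySlice_of_filtered` (`RasmussenSliceProofs.lean`),
`abs_le_two_mul_sliceGenus_of_filtered` (`RasmussenSliceGenusProofs.lean`) and
`HasRasmussenInvariant.eq_of_isConcordant_of_filtered` (`RasmussenConcordanceProofs.lean`).
Rasmussen (2010), Cor. 4.2 (*"`φ_S` is an isomorphism"*, injectivity half), Prop. 4.1;
Lee (2005), Thm. 4.2. [cite: Rasmussen2010, Cor. 4.2] -/
theorem mk_eq_zero_of_canonical (hG : ∃ K : Knot, K.HasGaussDiagram G)
    (F : (G.degStates 0 → ℚ) →ₗ[ℚ] (G'.degStates 0 → ℚ))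
    (hFB : ∀ z ∈ G.leeCycles, F z ∈ G'.leeCycles)
    (hFA : ∀ y, F (G.khovanovD ℚ 0 1 (0 - 1) 0 y) ∈
      LinearMap.range (G'.khovanovD ℚ 0 1 (0 - 1) 0))
    (e : {s : G.degStates 0 // ∀ i, ¬ G.Free s.1.label i} →
      {u : G'.degStates 0 // ∀ i, ¬ G'.Free u.1.label i})
    (he : Injective e)
    (htrack : ∀ s, ∃ c : ℚ, c ≠ 0 ∧
      F ((G.leeCoord 0).symm (Pi.single s.1 1)) - c • (G'.leeCoord 0).symm (Pi.single (e s).1 1)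
        ∈ LinearMap.range (G'.khovanovD ℚ 0 1 (0 - 1) 0))
    (z : G.leeCycles)
    (h : (Submodule.Quotient.mk ⟨F z, hFB z z.2⟩ : G'.LeeHomologyZero) = 0) :
    (Submodule.Quotient.mk z : G.LeeHomologyZero) = 0 := by
  rw [Submodule.Quotient.mk_eq_zero, Submodule.mem_comap] at h ⊢
  exact mem_range_of_canonical hG F hFA e he htrack z.2 h

end Corollary

end GaussDiagram

/-! ## The assembly with chain-level hypotheses -/

/-- **The assembly of Rasmussen's argument for slice knots, chain level.** Suppose that for every
regular projection `P` of every smoothly slice knot there are linear maps of degree-zero Lee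
chains `F : C⁰(P.diagram) → C⁰(U)` and `Ψ : C⁰(U) → C⁰(P.diagram)`, `U = GaussDiagram.empty` the
crossingless diagram of the round unknot, each of which (i) maps cycles to cycles and
(ii) boundaries to boundaries (as a chain map does), (iii) does not decrease the filtration
degree `qMin` (filtered of degree `χ(C) = 0`, Rasmussen (2010), §4.2), and (iv) sends the
canonical generator of each canonical state to a nonzero multiple of the canonical generator of a
canonical state of the target modulo boundaries, injectively on canonical states (the claim in
the proof of Prop. 4.1 for a connected cobordism between knots). In Rasmussen's proof these are
the chain maps of the concordance `C : K → U` cut out of a slice disc and of its reverse,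
composed from the elementary maps of a movie of Reidemeister and Morse moves (§4.1–4.3, §6).
Then every smoothly slice knot has `s = 0`, i.e. the named fact `eq_zero_of_isSmoothlySlice`
holds: Corollary 4.2 (`GaussDiagram.mk_eq_zero_of_canonical`, using Lee's theorem at both knot
ends — `P.diagram` is realised by `K`, `GaussDiagram.empty` by the unknot,
`unknot_hasGaussDiagram_empty_holds`) turns (i)–(iv) into the hypotheses of
`eq_zero_of_isSmoothlySlice_of_filtered`. Rasmussen (2010), Thm. 1 and its proof (§4.4, p. 10),
Cor. 4.2, Prop. 4.1. [cite: Rasmussen2010, Thm. 1] -/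
theorem eq_zero_of_isSmoothlySlice_of_canonical
    (h : ∀ {K : Knot} (P : K.RegularProjection), K.IsSmoothlySlice →
      (∃ F : (P.diagram.degStates 0 → ℚ) →ₗ[ℚ] (GaussDiagram.empty.degStates 0 → ℚ),
        (∀ z ∈ P.diagram.leeCycles, F z ∈ GaussDiagram.empty.leeCycles) ∧
        (∀ y, F (P.diagram.khovanovD ℚ 0 1 (0 - 1) 0 y) ∈
          LinearMap.range (GaussDiagram.empty.khovanovD ℚ 0 1 (0 - 1) 0)) ∧
        (∀ x, GaussDiagram.qMin x ≤ GaussDiagram.qMin (F x)) ∧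
        ∃ e : {s : P.diagram.degStates 0 // ∀ i, ¬ P.diagram.Free s.1.label i} →
            {u : GaussDiagram.empty.degStates 0 // ∀ i, ¬ GaussDiagram.empty.Free u.1.label i},
          Injective e ∧ ∀ s, ∃ c : ℚ, c ≠ 0 ∧
            F ((P.diagram.leeCoord 0).symm (Pi.single s.1 1)) -
                c • (GaussDiagram.empty.leeCoord 0).symm (Pi.single (e s).1 1) ∈
              LinearMap.range (GaussDiagram.empty.khovanovD ℚ 0 1 (0 - 1) 0)) ∧
      (∃ Ψ : (GaussDiagram.empty.degStates 0 → ℚ) →ₗ[ℚ] (P.diagram.degStates 0 → ℚ),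
        (∀ w ∈ GaussDiagram.empty.leeCycles, Ψ w ∈ P.diagram.leeCycles) ∧
        (∀ y, Ψ (GaussDiagram.empty.khovanovD ℚ 0 1 (0 - 1) 0 y) ∈
          LinearMap.range (P.diagram.khovanovD ℚ 0 1 (0 - 1) 0)) ∧
        (∀ x, GaussDiagram.qMin x ≤ GaussDiagram.qMin (Ψ x)) ∧
        ∃ e : {u : GaussDiagram.empty.degStates 0 // ∀ i, ¬ GaussDiagram.empty.Free u.1.label i} →
            {s : P.diagram.degStates 0 // ∀ i, ¬ P.diagram.Free s.1.label i},
          Injective e ∧ ∀ u, ∃ c : ℚ, c ≠ 0 ∧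
            Ψ ((GaussDiagram.empty.leeCoord 0).symm (Pi.single u.1 1)) -
                c • (P.diagram.leeCoord 0).symm (Pi.single (e u).1 1) ∈
              LinearMap.range (P.diagram.khovanovD ℚ 0 1 (0 - 1) 0))) :
    eq_zero_of_isSmoothlySlice := by
  refine eq_zero_of_isSmoothlySlice_of_filtered fun {K} P hs ↦ ?_
  obtain ⟨⟨F, hFB, hFA, hFq, e, he, htrack⟩, ⟨Ψ, hΨB, hΨA, hΨq, e', he', htrack'⟩⟩ := h P hs
  have hG : ∃ K' : Knot, K'.HasGaussDiagram P.diagram := ⟨K, P, rfl⟩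
  have hU : ∃ K' : Knot, K'.HasGaussDiagram GaussDiagram.empty :=
    ⟨unknot, unknot_hasGaussDiagram_empty_holds⟩
  exact ⟨fun z ↦ ⟨F z, hFB z z.2⟩, fun w ↦ ⟨Ψ w, hΨB w w.2⟩,
    GaussDiagram.mk_eq_zero_of_canonical hG F hFB hFA e he htrack, fun z ↦ hFq z.1,
    GaussDiagram.mk_eq_zero_of_canonical hU Ψ hΨB hΨA e' he' htrack', fun w ↦ hΨq w.1⟩

end Literature.Topology.FourManifolds
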